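import Literature.AnabelianGeometry.AbsoluteAnabelian.MLFGaloisPairs
import Literature.AnabelianGeometry.SemiGraphs.TemperedAnabelian

/-!
# Monoid cyclotomes, Kummer maps and unit Kummer maps ([AbsTopIII] Prop 3.2, Rmk 3.2.1–3.2.2,
# Prop 3.3, Rmk 3.1.1–3.1.3)

Statements-first typing (D-0014) of S. Mochizuki, *Topics in absolute anabelian geometry III*, §3,
Proposition 3.2 (i)–(v) pp.71–72 and Proposition 3.3 (i), (ii) pp.73–74 (bib key
`MochizukiAbsTopIII2015`; locators = kurims manuscript pages, lit key `paper:url-5493eb38cbb7`).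

What is typed and how.
* `Ẑ` is the tree's profinite completion of `ℤ` (`SemiGraphs.ZHat`, Mathlib `ProfiniteCompletion`),
  written additively (`ZhatAdd`), the target of "`H²(G, μ_Ẑ(M)) ⥲ Ẑ`"; the cyclotome `μ_Ẑ(M)` is the
  tree's `EtaleTheta.cyclotome Mˣ` (via `MLFGaloisModel.cyclotome`).
* The cohomology groups `H¹(H, μ_Ẑ(M))` (for open `H ⊆ Π`) and `H²(G, μ_Ẑ(M))` of the text are
  CONTINUOUS cohomology of profinite groups with profinite coefficients, which Mathlib does not have
  (its `groupCohomology` is for discrete groups); they enter as the INTERFACE `ContCohomologyData`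
  (abelian groups indexed by open subgroups, with restriction maps), TODO-construct.
* Prop 3.2 (i) (the natural isomorphism `H²(G, μ_Ẑ(M_TM)) ⥲ Ẑ` via Brauer groups and
  `G ↠ G^unr ⥲ Ẑ` of Cor 1.10 (b)), (ii) (Kummer maps `M^H → H¹(H, μ_Ẑ(M))`, `M → lim H¹(J, μ_Ẑ(M))`),
  Rmk 3.2.1 (the induced `μ_Ẑ(M) ⥲ μ_Ẑ(G)`), (iii) (the additive structure on the image of the Kummer
  map ∪ {0}, from Cor 1.10 (h)) are typed as the NAMED OUTPUT FIELDS of the structure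
  `MonoidKummerTheory` (c312-4 / LLANA N9 consume them by name: `h2Iso`, `kummer`, `kummerLim`,
  `cycIso`, `addStr`), each field's docstring quoting print; (iv) (`Isom` injection / bijection,
  centre-freeness, id-rigidity) and (v) (factorisation `𝔩𝔬𝔤_{T,T'}`, `𝔩𝔬𝔤_{T,T} ≅ id`) as named
  `Prop` facts over the pair types of `MLFGaloisPairs`.
* Prop 3.3 (i), (ii): unit Kummer maps for `T ∈ {TLG, TCG}` with the `{±1}`- / `Ẑ^×`-indeterminacy
  of `μ_Ẑ(M) ⥲ μ_Ẑ(G)`, as `UnitKummerTheory` + named `Prop` facts.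
* Rmk 3.1.1 (topology is determined by the algebraic structure; `𝒪_k̄^× ⊆ k̄^×` = the elements
  divisible by arbitrary powers of some prime — typed as a named `Prop`), Rmk 3.1.3 / 3.2.2 recorded.

"Of hyperbolic orbicurve type" / "of strictly Belyi type" (hypotheses of (ii)-bis, (iii), (iv)) are
scheme-theoretic conditions on `Π_k ↠ G_k`; they enter as hypothesis PREDICATES on model data
(`IsOfStrictlyBelyiType` etc. as parameters), owner seat abc-iut-L4-t1 — TODO-merge.
-/

namespace Literature.AnabelianGeometry.AbsoluteAnabelian

open _root_.Topology
open scoped _root_.ValuativeRel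

universe u

noncomputable section

/-! ### `Ẑ` and the continuous-cohomology interface -/

/-- `Ẑ`: the tree's profinite completion of `ℤ` (`Literature.AnabelianGeometry.SemiGraphs.ZHat` =
Mathlib `ProfiniteGrp.ProfiniteCompletion.completion (Multiplicative ℤ)`), written additively and lifted
to the ambient universe — the target of "`H²(G, μ_Ẑ(M)) ⥲ Ẑ`". [folklore] -/
abbrev ZhatAdd : Type u := ULift.{u} (Additive (Literature.AnabelianGeometry.SemiGraphs.ZHat))

/-- **Interface: continuous cohomology** of the open subgroups of a topological group `Π` with
coefficients in a (profinite) `Π`-module — here only the shape used by Prop 3.2/3.3: abelian groups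
`H¹(H, μ)` for open subgroups `H`, with restriction maps, and `H²(G, μ)` for the arithmetic quotient.
TODO-construct / TODO-merge: Mathlib's `ContCohomology` (homogeneous continuous cochains on `TopRep`)
or, in degree 1, the tree's crossed-homomorphism `EtaleTheta.ContH1` (coefficients there are an
abelian normal subgroup acted on by conjugation; here they are the cyclotome `μ_Ẑ(M)`).
[cite: MochizukiAbsTopIII2015, Proposition 3.2 (ii) p.71] -/
structure ContCohomologyData (P : Type u) [Group P] [TopologicalSpace P] : Type (u + 1) where
  /-- `H¹(H, μ_Ẑ(M))` for an open subgroup `H ⊆ Π`. -/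
  H1 : OpenSubgroup P → Type u
  [grpH1 : ∀ H, AddCommGroup (H1 H)]
  /-- Restriction `H¹(H, μ) → H¹(J, μ)` for `J ≤ H`. -/
  res : ∀ {H J : OpenSubgroup P}, J ≤ H → (H1 H →+ H1 J)
  res_id : ∀ H : OpenSubgroup P, res (le_refl H) = AddMonoidHom.id _
  res_comp : ∀ {H J L : OpenSubgroup P} (h₁ : J ≤ H) (h₂ : L ≤ J),
    res (h₂.trans h₁) = (res h₂).comp (res h₁)
  /-- `H²(G, μ_Ẑ(M))` of the arithmetic Galois group. -/
  H2 : Type u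
  [grpH2 : AddCommGroup H2]

attribute [instance] ContCohomologyData.grpH1 ContCohomologyData.grpH2

/-- The direct limit `lim→_J H¹(J, μ_Ẑ(M))` over open subgroups, as the quotient of
`Σ J, H¹(J, μ)` by eventual agreement under restriction.
[cite: MochizukiAbsTopIII2015, Proposition 3.2 (ii) p.71] -/
def ContCohomologyData.H1Lim {P : Type u} [Group P] [TopologicalSpace P] (C : ContCohomologyData P) :
    Type u :=
  Quot (fun a b : (Σ J : OpenSubgroup P, C.H1 J) =>
    ∃ (L : OpenSubgroup P) (ha : L ≤ a.1) (hb : L ≤ b.1), C.res ha a.2 = C.res hb b.2)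

/-! ### Proposition 3.2: monoid cyclotomes and Kummer maps -/

/-- **Prop 3.2 (i)–(iii) + Rmk 3.2.1 as named output fields.**  For `T ∈ {TM, TF}` and an MLF-Galois
`TM`-pair `(Π ↷ M)` (the `TM`-object `M_TM`; for `T = TF` obtained by the natural functor), with
arithmetic Galois group `Π ↠ G`:
(i) "a functorial algorithm for constructing the natural isomorphism `H²(G, μ_Ẑ(M_TM)) ⥲ Ẑ`" (via the
Brauer-group isomorphisms `H²(G, μ_{ℚ/ℤ}(M)) ⥲ H²(G, M^gp) ⭉ H²(G^unr, (M^unr)^gp) ⥲ … ⥲ H²(Ẑ, ℤ) ⥲ ℚ/ℤ`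
and `Hom(ℚ/ℤ, −)`) — field `h2Iso`;
Rmk 3.2.1: "a functorial algorithm for constructing the natural isomorphism `μ_Ẑ(M_TM) ⥲ μ_Ẑ(G)`" —
field `cycIso` (with `μ_Ẑ(G)` the cyclotome of Cor 1.10 (a), given as the datum `muG`);
(ii) "the Kummer maps `M^H_TM → H¹(H, μ_Ẑ(M_TM))`, `M_TM → lim→_J H¹(J, μ_Ẑ(M_TM))`" obtained "by
considering the action of open subgroups `H ⊆ Π` on elements of `M_TM` that are roots of elements of
`M^H_TM`" — fields `kummer`, `kummerLim`, natural in `H`;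
(iii) (strictly Belyi type) "an additive structure [hence … a topological field structure] on the
union with `{0}` of the group generated by the image of the Kummer map" — field `addStr` (a field
structure on a type `F` receiving the image ∪ {0} injectively and multiplicatively).
[cite: MochizukiAbsTopIII2015, Proposition 3.2 (i)–(iii) pp.71–72] -/
structure MonoidKummerTheory (P : GaloisMonoidPair.{u}) : Type (u + 1) where
  /-- The continuous cohomology of `Π` with coefficients `μ_Ẑ(M)`. -/
  coh : ContCohomologyData P.Pi
  /-- (i) `H²(G, μ_Ẑ(M_TM)) ⥲ Ẑ`. -/
  h2Iso : coh.H2 ≃+ ZhatAdd.{u}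
  /-- The cyclotome `μ_Ẑ(G)` "associated to `G`" (Cor 1.10 (a); seat abc-iut-L4-t1). -/
  muG : Type u
  [grpMuG : CommGroup muG]
  /-- Rmk 3.2.1: `μ_Ẑ(M_TM) ⥲ μ_Ẑ(G)`. -/
  cycIso : cyclotome P.M ≃* muG
  /-- (ii) the Kummer map on `H`-invariants, `M^H → H¹(H, μ_Ẑ(M))`. -/
  kummer : ∀ H : OpenSubgroup P.Pi,
    ({m : P.M // ∀ h : H, (h : P.Pi) • m = m} → coh.H1 H)
  kummer_mul : ∀ (H : OpenSubgroup P.Pi) (m m' : {m : P.M // ∀ h : H, (h : P.Pi) • m = m}),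
    kummer H ⟨m.1 * m'.1, fun h => by rw [smul_mul', m.2 h, m'.2 h]⟩ = kummer H m + kummer H m'
  kummer_res : ∀ {H J : OpenSubgroup P.Pi} (hJH : J ≤ H) (m : {m : P.M // ∀ h : H, (h : P.Pi) • m = m}),
    coh.res hJH (kummer H m) = kummer J ⟨m.1, fun j => m.2 ⟨j.1, hJH j.2⟩⟩
  /-- (ii) the Kummer map `M → lim→_J H¹(J, μ_Ẑ(M))` (every `m` is fixed by an open subgroup). -/
  kummerLim : P.M → coh.H1Lim
  kummerLim_spec : ∀ (m : P.M) (H : OpenSubgroup P.Pi) (hm : ∀ h : H, (h : P.Pi) • m = m),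
    kummerLim m = Quot.mk _ ⟨H, kummer H ⟨m, hm⟩⟩
  /-- (iii) the additive structure: a field `F` with an injective multiplicative map from `M`
  through which the Kummer map factors ("the union with `{0}` of the group generated by the image of
  the Kummer map" acquires "a topological field structure"). -/
  F : Type u
  [fieldF : Field F]
  addStr : P.M →* F
  addStr_injective : Function.Injective addStr
  addStr_ne_zero : ∀ m, addStr m ≠ 0

attribute [instance] MonoidKummerTheory.grpMuG MonoidKummerTheory.fieldF

/-- **Prop 3.2 (iv)**, injectivity: "the natural functor of Definition 3.1, (iii), induces an injection
`Isom((Π ↷ M_T), (Π* ↷ M*_T)) ↪ Isom_TG(Π, Π*)`" — an isomorphism of MLF-Galois `TM`-pairs is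
determined by its Galois component.  Named `Prop` fact.
[cite: MochizukiAbsTopIII2015, Proposition 3.2 (iv) p.72] -/
def PairIsoDeterminedByGalois : Prop :=
  ∀ (P Q : GaloisMonoidPair.{0}), IsMLFGaloisMonoidPair .TM P → IsMLFGaloisMonoidPair .TM Q →
    ∀ e₁ e₂ : GaloisMonoidPair.Iso P Q, e₁.isoPi = e₂.isoPi → e₁.isoM = e₂.isoM

/-- **Prop 3.2 (iv)**, bijectivity for `T = TM`, IN THE AUTHOR'S CORRECTED FORM ("Comments on
[AbsTopIII]" (June 2019), item (5): the printed phrase "if `T = TM`, or" is REPLACED by "if `T = TM`, and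
`(Π ↷ M_T)`, `(Π* ↷ M*_T)` are of hyperbolic orbicurve type, or" — proof pointer [Mzk20] Thm 2.6 (v)):
for MLF-Galois `TM`-pairs OF HYPERBOLIC ORBICURVE TYPE, every isomorphism of topological groups
`Π ⥲ Π*` that respects the arithmetic quotients (an isomorphism of `𝒯𝒢`, Def 3.1 (iii): it maps the
kernel of the action of `Π` onto that of `Π*`; audit A21-F3) lifts to an isomorphism of pairs ("this
injection is a bijection").  Typed as a `Prop` SCHEMA over the hypothesis predicate
`IsOfHypOrbicurveType` (scheme-theoretic origin of `Π ↠ G`; seat abc-iut-L4-t1, TODO-merge), exactly as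
`AutPairCenterFree` below; the pre-erratum typing (no orbicurve hypothesis; revision of 2026-08-25,
abc-iut cell ERRATA-CHECK AbsTopIII (5)) asserted more than the corrected print.  HONEST FRAMING: the
quotient-compatibility binder is what "of hyperbolic orbicurve type" supplies in print ([Mzk20] Thm
2.6 (v)); both are kept.  Named `Prop` fact (schema); not asserted.
[cite: MochizukiAbsTopIII2015, Proposition 3.2 (iv) p.72]
[cite: MochizukiAbsTopIIIComments2019, item (5)] -/
def GaloisIsoLiftsToTMPairIso (IsOfHypOrbicurveType : GaloisMonoidPair.{0} → Prop) : Prop :=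
  ∀ (P Q : GaloisMonoidPair.{0}), IsMLFGaloisMonoidPair .TM P → IsMLFGaloisMonoidPair .TM Q →
    IsOfHypOrbicurveType P → IsOfHypOrbicurveType Q →
    ∀ f : P.Pi ≃ₜ* Q.Pi, P.actionKer.map f.toMulEquiv.toMonoidHom = Q.actionKer →
      ∃ e : GaloisMonoidPair.Iso P Q, e.isoPi = f

/-- **Prop 3.2 (iv)**, centre-freeness: for `(Π ↷ M_T)` of hyperbolic orbicurve type,
"`Aut((Π ↷ M_T))` … is center-free" — typed over the hypothesis predicate `IsOfHypOrbicurveType`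
(scheme-theoretic origin of `Π ↠ G`; seat abc-iut-L4-t1, TODO-merge): the group of
self-isomorphisms has trivial centre.  Named `Prop` schema.
[cite: MochizukiAbsTopIII2015, Proposition 3.2 (iv) p.72] -/
def AutPairCenterFree (IsOfHypOrbicurveType : GaloisMonoidPair.{0} → Prop) : Prop :=
  ∀ P : GaloisMonoidPair.{0}, IsMLFGaloisMonoidPair .TM P → IsOfHypOrbicurveType P →
    ∀ e : GaloisMonoidPair.Iso P P,
      (∀ e' : GaloisMonoidPair.Iso P P, ∀ x, e.isoM (e'.isoM x) = e'.isoM (e.isoM x)) →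
      (∀ e' : GaloisMonoidPair.Iso P P, ∀ g, e.isoPi (e'.isoPi g) = e'.isoPi (e.isoPi g)) →
      (∀ x, e.isoM x = x) ∧ ∀ g, e.isoPi g = g

/-- **Prop 3.2 (v)** as a PROPERTY of a Kummer theory `T` on the model `TM`-pair of `(k, k̄, Π_k ↠ G_k)`
(strictly Belyi type): "the algorithm of (iii) yields a natural [1-]factorization
`𝒞^{MLF-sB}_TF → 𝒞^{MLF-sB}_T →^{𝔩𝔬𝔤_{T,T'}} 𝒞^{MLF-sB}_{T'}` … of the log-Frobenius functors", and "`𝔩𝔬𝔤_{T,T}` is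
isomorphic to the identity functor" — at the level of objects: the field `F` of (iii) recovers `k̄`, i.e.
there is a field isomorphism `F ≃+* k̄` under which `addStr` becomes the inclusion `𝒪_k̄^⊳ ⊆ k̄`.  (A
predicate on `T`, not a closed fact: the Kummer theory CONSTRUCTED by Cor 1.10 (h) — seat abc-iut-L4-t1
— is asserted to have it; ruling θ of the L4 lead.)
[cite: MochizukiAbsTopIII2015, Proposition 3.2 (v) p.72] -/
def MonoidKummerTheory.RecoversClosure (C : MLFClosure.{u}) {Q : GaloisMonoidPair.{u}}
    (T : MonoidKummerTheory Q) (j : Q.M → C.K) : Prop :=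
  ∃ e : T.F ≃+* C.K, (∀ m, e (T.addStr m) = j m) ∧ Set.range j = (nonzeroIntegers C.k C.K : Set C.K)

/-! ### Proposition 3.3: unit Kummer maps -/

/-- **Prop 3.3 (i), (ii) as named output fields** for `T ∈ {TLG, TCG}` and an MLF-Galois `T`-pair
`(Π ↷ M)`: (i) "the Kummer maps `M^H → H¹(H, μ_Ẑ(M))`, `M → lim→_J H¹(J, μ_Ẑ(M))`" (as in Prop 3.2 (ii));
"in this situation [unlike Prop 3.2 (ii)] the natural isomorphism `μ_Ẑ(M) ⥲ μ_Ẑ(G)` is only determined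
up to a `{±1}`- (respectively, `Ẑ^×`-) multiple if `T = TLG` (respectively, `T = TCG`)" — field
`cycIsoClass`: a NONEMPTY SET of isomorphisms that is a torsor under `{±1}` resp. `Ẑ^×` (typed: any
two members differ by an automorphism `u` of the cyclotome `μ_Ẑ(M) ≅ Ẑ` — these automorphisms form
`Ẑ^×` — which for `T = TLG` is `ζ ↦ ζ^{±1}`).
[cite: MochizukiAbsTopIII2015, Proposition 3.3 (i) p.73] -/
structure UnitKummerTheory (T : PairType) (P : GaloisMonoidPair.{u}) : Type (u + 1) where
  /-- Continuous cohomology data. -/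
  coh : ContCohomologyData P.Pi
  /-- `μ_Ẑ(G)`. -/
  muG : Type u
  [grpMuG : CommGroup muG]
  /-- (i) the class of natural isomorphisms `μ_Ẑ(M) ⥲ μ_Ẑ(G)`. -/
  cycIsoClass : Set (cyclotome P.M ≃* muG)
  cycIsoClass_nonempty : cycIsoClass.Nonempty
  /-- Any two members differ by an automorphism `u` of the cyclotome (`∈ Ẑ^×`), which for `T = TLG`
  is `id` or inversion. -/
  cycIsoClass_torsor : ∀ e₁ ∈ cycIsoClass, ∀ e₂ ∈ cycIsoClass,
    ∃ u : cyclotome P.M ≃* cyclotome P.M,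
      (T = .TLG → (u = MulEquiv.refl _ ∨ u = MulEquiv.inv (cyclotome P.M))) ∧
      ∀ ζ : cyclotome P.M, e₂ ζ = e₁ (u ζ)
  cycIsoClass_full : ∀ e₁ ∈ cycIsoClass, ∀ u : cyclotome P.M ≃* cyclotome P.M,
    (T = .TLG → (u = MulEquiv.refl _ ∨ u = MulEquiv.inv (cyclotome P.M))) →
    ∃ e₂ ∈ cycIsoClass, ∀ ζ : cyclotome P.M, e₂ ζ = e₁ (u ζ)
  /-- (i) Kummer maps. -/
  kummer : ∀ H : OpenSubgroup P.Pi, ({m : P.M // ∀ h : H, (h : P.Pi) • m = m} → coh.H1 H)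
  kummerLim : P.M → coh.H1Lim

attribute [instance] UnitKummerTheory.grpMuG

/-- **Prop 3.3 (ii)**: an isomorphism `(Π ↷ M) ⥲ (Π* ↷ M*)` induces `Π ⥲ Π*`, `μ_Ẑ(M) ⥲ μ_Ẑ(M*)`, which
determine an injection `Isom((Π ↷ M),(Π* ↷ M*)) ↪ Isom(Π,Π*) × Isom(μ_Ẑ(M), μ_Ẑ(M*))`, "a bijection if
`T = TCG`"; "if `T = TLG`, then `Isom((Π ↷ M),(Π* ↷ M*)) → Isom(Π, Π*)` is surjective, with fibers of
cardinality two".  Typed: determination by the two components (conjunct 1 — UNCONDITIONAL also in the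
author's corrected statement); for `TLG`, over each `𝒯𝒢`-isomorphism `Π ⥲ Π*` (respecting the
arithmetic quotients, audit A21-F3) there are exactly two isomorphisms of pairs (conjunct 2 — the
PRE-ERRATUM form: the author's "Comments on [AbsTopIII]" (June 2019), item (5), add "and `(Π ↷ M)`,
`(Π* ↷ M*)` are of hyperbolic orbicurve type" to the `TCG` bijectivity and the `TLG` surjectivity
clauses; the CORRECTED form of these clauses is `UnitPairIsoFibresOfType` below; this declaration is
kept byte-identical for its consumers — seat abc-iut-L6-t21 proves conjunct 1 and reduces conjunct 2 to
a pure existence-of-lifts statement).  Named `Prop` fact.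
[cite: MochizukiAbsTopIII2015, Proposition 3.3 (ii) p.74]
[cite: MochizukiAbsTopIIIComments2019, item (5)] -/
def UnitPairIsoFibres : Prop :=
  (∀ (T : PairType) (P Q : GaloisMonoidPair.{0}), (T = .TLG ∨ T = .TCG) →
    IsMLFGaloisMonoidPair T P → IsMLFGaloisMonoidPair T Q →
    ∀ e₁ e₂ : GaloisMonoidPair.Iso P Q, e₁.isoPi = e₂.isoPi →
      (∀ ζ : cyclotome P.M,
        Literature.AnabelianGeometry.EtaleTheta.cyclotome.map (Units.map e₁.isoM.toMonoidHom) ζ =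
        Literature.AnabelianGeometry.EtaleTheta.cyclotome.map (Units.map e₂.isoM.toMonoidHom) ζ) →
      e₁.isoM = e₂.isoM) ∧
  (∀ (P Q : GaloisMonoidPair.{0}), IsMLFGaloisMonoidPair .TLG P → IsMLFGaloisMonoidPair .TLG Q →
    ∀ f : P.Pi ≃ₜ* Q.Pi, P.actionKer.map f.toMulEquiv.toMonoidHom = Q.actionKer →
      ∃ e₁ e₂ : GaloisMonoidPair.Iso P Q, e₁.isoPi = f ∧ e₂.isoPi = f ∧
      e₁.isoM ≠ e₂.isoM ∧ ∀ e : GaloisMonoidPair.Iso P Q, e.isoPi = f → (e.isoM = e₁.isoM ∨ e.isoM = e₂.isoM))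

/-- **Prop 3.3 (ii), surjectivity clauses IN THE AUTHOR'S CORRECTED FORM** ("Comments on [AbsTopIII]"
(June 2019), item (5): "a bijection if `T = TCG`, and `(Π ↷ M)`, `(Π* ↷ M*)` are of hyperbolic orbicurve
type.  If `T = TLG`, and `(Π ↷ M)`, `(Π* ↷ M*)` are of hyperbolic orbicurve type, then the homomorphism
`Isom_{𝒞^MLF_T}((Π ↷ M),(Π* ↷ M*)) → Isom_{𝒯𝒢}(Π, Π*)` is surjective, with fibers of cardinality two").
Typed as a `Prop` SCHEMA over the hypothesis predicate `IsOfHypOrbicurveType` (seat abc-iut-L4-t1,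
TODO-merge), for `𝒯𝒢`-isomorphisms `f : Π ⥲ Π*` respecting the arithmetic quotients (audit A21-F3):
for `T = TCG`, every pair (`f`, isomorphism of cyclotomes `u : μ_Ẑ(M) ⥲ μ_Ẑ(M*)`) is realised by an
isomorphism of pairs (surjectivity onto the product — together with conjunct 1 of `UnitPairIsoFibres`
this is the corrected "bijection"); for `T = TLG`, over each such `f` there are exactly two
isomorphisms of pairs.  Named `Prop` fact (schema); not asserted.
[cite: MochizukiAbsTopIII2015, Proposition 3.3 (ii) p.74]
[cite: MochizukiAbsTopIIIComments2019, item (5)] -/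
def UnitPairIsoFibresOfType (IsOfHypOrbicurveType : GaloisMonoidPair.{0} → Prop) : Prop :=
  (∀ (P Q : GaloisMonoidPair.{0}), IsMLFGaloisMonoidPair .TCG P → IsMLFGaloisMonoidPair .TCG Q →
    IsOfHypOrbicurveType P → IsOfHypOrbicurveType Q →
    ∀ f : P.Pi ≃ₜ* Q.Pi, P.actionKer.map f.toMulEquiv.toMonoidHom = Q.actionKer →
    ∀ u : cyclotome P.M ≃* cyclotome Q.M,
      ∃ e : GaloisMonoidPair.Iso P Q, e.isoPi = f ∧
        ∀ ζ : cyclotome P.M,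
          Literature.AnabelianGeometry.EtaleTheta.cyclotome.map (Units.map e.isoM.toMonoidHom) ζ = u ζ) ∧
  (∀ (P Q : GaloisMonoidPair.{0}), IsMLFGaloisMonoidPair .TLG P → IsMLFGaloisMonoidPair .TLG Q →
    IsOfHypOrbicurveType P → IsOfHypOrbicurveType Q →
    ∀ f : P.Pi ≃ₜ* Q.Pi, P.actionKer.map f.toMulEquiv.toMonoidHom = Q.actionKer →
      ∃ e₁ e₂ : GaloisMonoidPair.Iso P Q, e₁.isoPi = f ∧ e₂.isoPi = f ∧
      e₁.isoM ≠ e₂.isoM ∧ ∀ e : GaloisMonoidPair.Iso P Q, e.isoPi = f → (e.isoM = e₁.isoM ∨ e.isoM = e₂.isoM))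

/-- **Mono-analytic variant of the `TM` bijectivity** — NOT asserted by [AbsTopIII] Prop. 3.2 (iv) as
corrected (the author's Comments (June 2019) item (5) restrict the bijection to pairs of hyperbolic
orbicurve / strictly Belyi type), but asserted in [IUTchII] Rmk. 1.11.1 (i) (a) (kurims manuscript
p. 50: for the mono-analytic MLF-Galois `TM`-pair `G ↷ 𝒪^⊳(G)`, "the group of automorphisms … maps
bijectively … onto the group of automorphisms of the topological group `G`"); mechanism = functoriality,
in arbitrary isomorphisms of topological groups, of the mono-analytic reconstruction of the `G`-monoid
`𝒪^⊳_k̄` from `G` ([AbsTopIII] Cor. 1.10, p. 42: "the asserted functoriality is with respect to arbitrary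
injective open homomorphisms of profinite groups"; [AbsAnab] Prop. 1.2.1, local class field theory).
Typed for two MLF-Galois `TM`-pairs OF MONO-ANALYTIC TYPE (`ε : Π ⥲ G` bijective and open, Def. 3.1 (ii);
the arithmetic kernel is then trivial, so no quotient-compatibility binder is needed): every isomorphism
of topological groups `Π ⥲ Π*` lifts to an isomorphism of pairs (print speaks of `Aut` of ONE pair; the
two-pair `Isom` form is the functoriality just cited).  Added at the request of the abc-iut cell's [IUTchII]
consumers (bridge register E-11 / G15-1); named `Prop` fact, not asserted.
[cite: MochizukiAbsTopIII2015, Corollary 1.10 p.42]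
[cite: Mochizuki2012, II Rmk 1.11.1 (i) p.50] -/
def GaloisIsoLiftsToTMPairIsoOfMonoAnalytic : Prop :=
  ∀ (P Q : GaloisMonoidPair.{0}), IsMLFGaloisMonoidPair .TM P → IsMLFGaloisMonoidPair .TM Q →
    IsOfMonoAnalyticTypeMonoid .TM P → IsOfMonoAnalyticTypeMonoid .TM Q →
    ∀ f : P.Pi ≃ₜ* Q.Pi, ∃ e : GaloisMonoidPair.Iso P Q, e.isoPi = f

/-- **Mono-analytic variant of the `TCG` surjectivity clause of Prop. 3.3 (ii)** — NOT asserted by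
[AbsTopIII] as corrected (Comments (June 2019) item (5)), but asserted in [IUTchII] Rmk. 1.11.1 (i) (b)
(kurims p. 50: for the mono-analytic pair `G ↷ 𝒪^×(G)`, "the group of automorphisms of the underlying
ind-topological module equipped with topological group action … maps surjectively … onto the group of
automorphisms of the topological group `G`, with kernel given by the [`G`-linear] automorphisms …
determined by the natural action of `Ẑ^×`"); same mechanism as `GaloisIsoLiftsToTMPairIsoOfMonoAnalytic`.
Typed for two MLF-Galois `TCG`-pairs of mono-analytic type, without quotient-compatibility binder: every
pair (`f : Π ⥲ Π*`, isomorphism of cyclotomes `u : μ_Ẑ(M) ⥲ μ_Ẑ(M*)`) is realised by an isomorphism of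
pairs (surjectivity onto `Aut(G)` with kernel the `Ẑ^×`-action, which acts on the cyclotome through all
of `Aut(μ_Ẑ) = Ẑ^×`).  The `TLG` analogue (two lifts over each `f` for `G ↷ k̄^×`) is NOT typed: no source
asserts it for mono-analytic pairs ([IUTchII] Rmk. 1.11.1 (i) (c) concerns `G ↷ 𝒪^{×̂gp}(G)`, the
ind-limit of profinite completions, with kernel `Ẑ^×`).  Named `Prop` fact, not asserted.
[cite: MochizukiAbsTopIII2015, Corollary 1.10 p.42]
[cite: Mochizuki2012, II Rmk 1.11.1 (i) p.50] -/
def TCGPairIsoLiftsOfMonoAnalytic : Prop :=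
  ∀ (P Q : GaloisMonoidPair.{0}), IsMLFGaloisMonoidPair .TCG P → IsMLFGaloisMonoidPair .TCG Q →
    IsOfMonoAnalyticTypeMonoid .TCG P → IsOfMonoAnalyticTypeMonoid .TCG Q →
    ∀ (f : P.Pi ≃ₜ* Q.Pi) (u : cyclotome P.M ≃* cyclotome Q.M),
      ∃ e : GaloisMonoidPair.Iso P Q, e.isoPi = f ∧
        ∀ ζ : cyclotome P.M,
          Literature.AnabelianGeometry.EtaleTheta.cyclotome.map (Units.map e.isoM.toMonoidHom) ζ = u ζ

/-! ### Remark 3.1.1 -/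

/-- **Rmk 3.1.1**: the topology on `k̄`, `k̄^×`, `𝒪_k̄^×`, `𝒪_k̄^⊳` "is completely determined by the field,
group, or monoid structures of these objects"; in particular "`𝒪_k̄^× ⊆ k̄^×` may be characterized as
the subgroup of elements divisible by arbitrary powers of some prime number" — to be read in the
ind-object `k̄^× = lim→ (k')^×` over finite subextensions (in `k̄^×` itself every element is divisible):
typed as: a non-zero `x` is a unit of `𝒪_k̄` iff, for some prime `ℓ`, `x` has `ℓ^n`-th roots IN THE
FIELD `k(x)` for all `n`.  Named `Prop` fact.
[cite: MochizukiAbsTopIII2015, Remark 3.1.1 p.70] -/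
def UnitsAreInfinitelyDivisibleElements : Prop :=
  ∀ (C : MLFClosure.{0}) (x : C.K), x ≠ 0 →
    (x ∈ unitSubmonoid C.k C.K ↔ ∃ ℓ : ℕ, ℓ.Prime ∧ ∀ n : ℕ,
      ∃ y : C.K, y ∈ IntermediateField.adjoin C.k ({x} : Set C.K) ∧ y ^ (ℓ ^ n) = x)

end

end Literature.AnabelianGeometry.AbsoluteAnabelian
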